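import Mathlib
import HarnessLib
import Summits.HubbardSuperconductivity.HubbardSuperconductivity.Theorems.KLProgrammeKLRegimeCountertermPieceLipschitz
import Summits.HubbardSuperconductivity.HubbardSuperconductivity.Theorems.KLProgrammeKLRegimeSplitBundleV6

/-!
# Route `KLProgramme` — the Counterterm child of crux K3 (gen-3 item stmt-HubbardSuperconductivity-19825 `KLRegimeCountertermV11`):
# THE PARTIAL SUMS OF A PICARD IMAGE `F′ = P^G(F) ⊖ D_n^G(F)` — the identity, the sup bound from (E3c-G) + (E3a-G) `j = 0`,
# and the Lipschitz constant of a partial sum from (E3a-G) `j = 1`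
# (seat hubbard-kl-k3c3-p1, part F; produces the inputs `B₀` and `Λ_ℓ` of the gate lemma `renormalisedAtF_of_partialSum_frame(OK)`)

The wholesale continuation (k3c3-p2) iterates, at level `n`, the counterterm map `F ↦ F′ := P^G(F) ⊖ D_n^G(F) = −Σ_{i ≤ n} ℓ_i^G(F)`
(the frame of `frameOK_of_multiSlot`).  The gate lemma of parts D/E reads `RenormalisedAtF … F′ R j` off a UNIFORM sup bound `B₀` of
`F′ ⊕ Σ_{i ≤ j} ℓ_i^G(F′)` and a sup-metric Lipschitz constant `Λ_ℓ` of `Σ_{i ≤ j} ℓ_i^G(F′)`.  Both come from the slots by pure algebra: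

* §1 `eval_counterImage` (`F′(q) = −Σ_{i ≤ n} ℓ_i^G(F)(q)`) and **`eval_counterImage_add_partialSum`**: for `j ≤ n`,
  `F′(q) + Σ_{i ≤ j} ℓ_i^G(F′)(q) = Σ_{i ≤ j} (ℓ_i^G(F′) − ℓ_i^G(F))(q) − Σ_{j < i ≤ n} ℓ_i^G(F)(q)` — the NEW frame's partial sum is
  the frame-response of the coarse pieces (an (E3c-G) quantity) minus the TAIL of the old frame's pieces (an (E3a-G) `j = 0` quantity);
* §2 **`abs_eval_counterImage_add_partialSum_le`**: `|F′(q) + Σ_{i ≤ j} ℓ_i^G(F′)(q)| ≤ (Σ_{i ≤ j} lip i)·d + Σ_{j < i ≤ n} b i` from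
  `|ℓ_i^G(F′)(q) − ℓ_i^G(F)(q)| ≤ lip i · d` (`i ≤ j`) and `|ℓ_i^G(F)(q)| ≤ b i` (`j < i ≤ n`) — the `B₀` of the gate lemma; at an exact
  fixed point (`d = 0`) only the tail remains;
* §3 `abs_partialSum_sub_le_of_sizes`: `Σ_{i ≤ j} ℓ_i^G(K)` is `(Σ_{i ≤ j} twoLegBar G Q U 1 i)`-Lipschitz in the `ℓ¹` momentum metric when
  (E3a-G) holds at every `i ≤ j` (k3c3-p3's `abs_eval_klTwoLegPieceG_sub_le_of_sizes`, summed) — the `Λ_ℓ` of the gate lemma — and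
  `sum_twoLegBar_one_le`: `Σ_{i < m} twoLegBar G Q U 1 i ≤ (4/3)·(G.S 1 + Q.S′ 1·|U|)·U²` (volume/β-free).

Proofs only; nothing is asserted about the Hubbard model.
-/

noncomputable section

namespace Summit.HubbardSuperconductivity.HubbardSuperconductivity.Theorems.KLRegimeSplit

set_option linter.dupNamespace false -- summit = problem name (single-conjunct summit), D-0017

open Real Finset
open Literature.MathematicalPhysics.QuantumLattice Literature.Probability.LatticeModels
open Summit.HubbardSuperconductivity.HubbardSuperconductivity.Theorems.KLProgrammeLegKernels

section Model

variable (L M : ℕ) [NeZero L] [NeZero M]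

/-! ## §1 The partial sums of the Picard image -/

/-- **The Picard image is minus the sum of the pieces**: `(P^G(F) ⊖ D_n^G(F))(q) = −Σ_{i ≤ n} ℓ_i^G(F)(q)`. -/
theorem eval_counterImage (β U μ : ℝ) (F : TrigPolyC4v) (n : ℕ) (q : Fin 2 → ℝ) :
    (fsub (klFrameProjG L μ F) (klTwoLegPolyG L M β U μ F n)).eval q =
      -∑ i ∈ range (n + 1), (klTwoLegPieceG L M β U μ F i).eval q := by
  rw [eval_fsub, sum_eval_klTwoLegPieceG]
  ring

/-- Splitting a sum over `range (n + 1)` at `j ≤ n`: `Σ_{i ≤ n} = Σ_{i ≤ j} + Σ_{j < i ≤ n}` (the tail as `Ico (j+1) (n+1)`). -/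
theorem sum_range_succ_eq_add_sum_Ico {f : ℕ → ℝ} {j n : ℕ} (hj : j ≤ n) :
    ∑ i ∈ range (n + 1), f i = ∑ i ∈ range (j + 1), f i + ∑ i ∈ Ico (j + 1) (n + 1), f i := by
  rw [range_eq_Ico, range_eq_Ico]
  exact (sum_Ico_consecutive f (Nat.zero_le _) (Nat.succ_le_succ hj)).symm

/-- **THE PARTIAL SUMS OF THE PICARD IMAGE.**  For `F′ = P^G(F) ⊖ D_n^G(F)` and `j ≤ n`:
`F′(q) + Σ_{i ≤ j} ℓ_i^G(F′)(q) = Σ_{i ≤ j} (ℓ_i^G(F′)(q) − ℓ_i^G(F)(q)) − Σ_{j < i ≤ n} ℓ_i^G(F)(q)`. -/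
theorem eval_counterImage_add_partialSum (β U μ : ℝ) (F : TrigPolyC4v) {j n : ℕ} (hj : j ≤ n) (q : Fin 2 → ℝ) :
    (fsub (klFrameProjG L μ F) (klTwoLegPolyG L M β U μ F n)).eval q +
        ∑ i ∈ range (j + 1), (klTwoLegPieceG L M β U μ (fsub (klFrameProjG L μ F) (klTwoLegPolyG L M β U μ F n)) i).eval q =
      ∑ i ∈ range (j + 1), ((klTwoLegPieceG L M β U μ (fsub (klFrameProjG L μ F) (klTwoLegPolyG L M β U μ F n)) i).eval q -
          (klTwoLegPieceG L M β U μ F i).eval q) -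
        ∑ i ∈ Ico (j + 1) (n + 1), (klTwoLegPieceG L M β U μ F i).eval q := by
  rw [eval_counterImage, sum_range_succ_eq_add_sum_Ico (f := fun i => (klTwoLegPieceG L M β U μ F i).eval q) hj, sum_sub_distrib]
  ring

/-! ## §2 The sup bound of the partial sums (the `B₀` of the gate lemma) -/

/-- **THE SUP BOUND.**  If the coarse pieces respond to the frame change by `|ℓ_i^G(F′)(q) − ℓ_i^G(F)(q)| ≤ lip i · d` (`i ≤ j`; (E3c-G)
with `d = frameDist F′ F`) and the old frame's fine pieces have `|ℓ_i^G(F)(q)| ≤ b i` (`j < i ≤ n`; (E3a-G) `j = 0`), then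
`|F′(q) + Σ_{i ≤ j} ℓ_i^G(F′)(q)| ≤ (Σ_{i ≤ j} lip i)·d + Σ_{j < i ≤ n} b i` at every `q`. -/
theorem abs_eval_counterImage_add_partialSum_le (β U μ : ℝ) (F : TrigPolyC4v) {j n : ℕ} (hj : j ≤ n) {lip b : ℕ → ℝ} {d : ℝ}
    (hlip : ∀ i ≤ j, ∀ q : Fin 2 → ℝ,
      |(klTwoLegPieceG L M β U μ (fsub (klFrameProjG L μ F) (klTwoLegPolyG L M β U μ F n)) i).eval q -
        (klTwoLegPieceG L M β U μ F i).eval q| ≤ lip i * d)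
    (hb : ∀ i, j < i → i ≤ n → ∀ q : Fin 2 → ℝ, |(klTwoLegPieceG L M β U μ F i).eval q| ≤ b i) (q : Fin 2 → ℝ) :
    |(fsub (klFrameProjG L μ F) (klTwoLegPolyG L M β U μ F n)).eval q +
        ∑ i ∈ range (j + 1), (klTwoLegPieceG L M β U μ (fsub (klFrameProjG L μ F) (klTwoLegPolyG L M β U μ F n)) i).eval q| ≤
      (∑ i ∈ range (j + 1), lip i) * d + ∑ i ∈ Ico (j + 1) (n + 1), b i := by
  rw [eval_counterImage_add_partialSum L M β U μ F hj q]
  refine (abs_sub _ _).trans (add_le_add ?_ ?_)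
  · rw [sum_mul]
    refine (abs_sum_le_sum_abs _ _).trans (sum_le_sum fun i hi => ?_)
    exact hlip i (Nat.lt_succ_iff.mp (mem_range.mp hi)) q
  · refine (abs_sum_le_sum_abs _ _).trans (sum_le_sum fun i hi => ?_)
    rw [mem_Ico] at hi
    exact hb i (Nat.lt_of_succ_le hi.1) (Nat.lt_succ_iff.mp hi.2) q

/-- **At an exact fixed point only the tail remains**: if `ℓ_i^G(F′) = ℓ_i^G(F)` pointwise for `i ≤ j` then
`|F′(q) + Σ_{i ≤ j} ℓ_i^G(F′)(q)| ≤ Σ_{j < i ≤ n} b i`. -/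
theorem abs_eval_counterImage_add_partialSum_le_tail (β U μ : ℝ) (F : TrigPolyC4v) {j n : ℕ} (hj : j ≤ n) {b : ℕ → ℝ}
    (hfix : ∀ i ≤ j, ∀ q : Fin 2 → ℝ,
      (klTwoLegPieceG L M β U μ (fsub (klFrameProjG L μ F) (klTwoLegPolyG L M β U μ F n)) i).eval q =
        (klTwoLegPieceG L M β U μ F i).eval q)
    (hb : ∀ i, j < i → i ≤ n → ∀ q : Fin 2 → ℝ, |(klTwoLegPieceG L M β U μ F i).eval q| ≤ b i) (q : Fin 2 → ℝ) :
    |(fsub (klFrameProjG L μ F) (klTwoLegPolyG L M β U μ F n)).eval q +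
        ∑ i ∈ range (j + 1), (klTwoLegPieceG L M β U μ (fsub (klFrameProjG L μ F) (klTwoLegPolyG L M β U μ F n)) i).eval q| ≤
      ∑ i ∈ Ico (j + 1) (n + 1), b i := by
  have h := abs_eval_counterImage_add_partialSum_le L M β U μ F hj (lip := fun _ => 0) (d := 0)
    (fun i hi q => by rw [hfix i hi q, sub_self, abs_zero]; norm_num) hb q
  simpa using h

/-! ## §3 The Lipschitz constant of a partial sum (the `Λ_ℓ` of the gate lemma) -/

/-- **A partial sum of the pieces is Lipschitz in the `ℓ¹` momentum metric** with constant `Σ_{i ≤ j} twoLegBar G Q U 1 i` when (E3a-G)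
holds at every `i ≤ j`. -/
theorem abs_partialSum_sub_le_of_sizes {G : GeoConsts} {Q : EngConsts} {R : RenConsts} {β U μ : ℝ} {K : TrigPolyC4v} {j : ℕ}
    (h : ∀ i ≤ j, TwoLegSizesG L M G Q R β U μ K i) (p p' : Fin 2 → ℝ) :
    |∑ i ∈ range (j + 1), (klTwoLegPieceG L M β U μ K i).eval p - ∑ i ∈ range (j + 1), (klTwoLegPieceG L M β U μ K i).eval p'| ≤
      (∑ i ∈ range (j + 1), twoLegBar G Q U 1 i) * (|p 0 - p' 0| + |p 1 - p' 1|) := by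
  rw [← sum_sub_distrib, sum_mul]
  refine (abs_sum_le_sum_abs _ _).trans (sum_le_sum fun i hi => ?_)
  exact abs_eval_klTwoLegPieceG_sub_le_of_sizes (h i (Nat.lt_succ_iff.mp (mem_range.mp hi))) p p'

end Model

/-- `twoLegBar G Q U 1 i = (G.S 1 + Q.S′ 1·|U|)·U²·4^{-i}`. -/
theorem twoLegBar_one_eq (G : GeoConsts) (Q : EngConsts) (U : ℝ) (i : ℕ) :
    twoLegBar G Q U 1 i = (G.S 1 + Q.S' 1 * |U|) * U ^ 2 * ((4 : ℝ) ^ i)⁻¹ := by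
  unfold twoLegBar uPow
  simp only [one_ne_zero, ↓reduceIte, Nat.cast_one]
  rw [show ((1 : ℤ) - 2) * (i : ℤ) = -(i : ℤ) by ring, zpow_neg, zpow_natCast]

/-- **The order-1 majorants sum to a volume/β-free constant**: `Σ_{i < m} twoLegBar G Q U 1 i ≤ (4/3)·(G.S 1 + Q.S′ 1·|U|)·U²`
(for `G.S 1 + Q.S′ 1·|U| ≥ 0`). -/
theorem sum_twoLegBar_one_le (G : GeoConsts) (Q : EngConsts) (U : ℝ) (hS : 0 ≤ G.S 1 + Q.S' 1 * |U|) (m : ℕ) :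
    ∑ i ∈ range m, twoLegBar G Q U 1 i ≤ 4 / 3 * (G.S 1 + Q.S' 1 * |U|) * U ^ 2 := by
  simp_rw [twoLegBar_one_eq]
  rw [← mul_sum]
  have hgeom : ∑ i ∈ range m, ((4 : ℝ) ^ i)⁻¹ ≤ 4 / 3 := by
    have e : ∀ i, ((4 : ℝ) ^ i)⁻¹ = (1 / 4 : ℝ) ^ i := fun i => by rw [one_div, inv_pow]
    simp_rw [e]
    have h := geom_sum_mul_neg (1 / 4 : ℝ) m
    have hp : 0 ≤ (1 / 4 : ℝ) ^ m := by positivity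
    linarith
  have hc : 0 ≤ (G.S 1 + Q.S' 1 * |U|) * U ^ 2 := mul_nonneg hS (sq_nonneg U)
  calc (G.S 1 + Q.S' 1 * |U|) * U ^ 2 * ∑ i ∈ range m, ((4 : ℝ) ^ i)⁻¹ ≤ (G.S 1 + Q.S' 1 * |U|) * U ^ 2 * (4 / 3) :=
        mul_le_mul_of_nonneg_left hgeom hc
    _ = 4 / 3 * (G.S 1 + Q.S' 1 * |U|) * U ^ 2 := by ring

end Summit.HubbardSuperconductivity.HubbardSuperconductivity.Theorems.KLRegimeSplit

end
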